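import Summits.QuantumFields.YangMills.Theorems.BalabanUVNodesN26AtBetaOfRecord11
import Literature.MathematicalPhysics.QuantumFieldTheory.Balaban1983to89.Beta.RemainderStepAdapterHolo

/-!
# DAG node N26 — B4 «β-continuity» AT `Node00.betaOfRecord₁₁ θ`: THE (D4)-CHAIN INSTANCE AT THE RECORD'S SPLIT `oneLoopSplitOfRecord₁₁ θ`
# BUILT BY NAME FROM THE CREW'S STEP-OBJECT (H-LAYER) CURRENCY — `Beta.RemainderStepAdapterHolo.StepObjectD4` ∕ `Lemma3OnH` ∕
# `toPolLeavesTFac190H_ofActivities` (row-(D4) owner `b2b-balaban-beta-an4`) — and «HOW B4 CLOSES AT THE RECORD FROM THE H-LAYER, in one statement»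

Cell `pub-ymgap`, YM-PLAN Track A (HUMAN RULING D-0062), seat `pub-ymgap-dag-n26-c` gen 2 (R134 acceleration re-seat, s2; director-ym row «the (D4)-chain INSTANCE
`Gaps.BetaContFromD4Chain.betaContH_of_chainTFac190H` for the datum of record at `betaOfRecord₁₁` (crew D4 files by name)»).  Second module of gen 2, over
`BalabanUVNodesN26AtBetaOfRecord11` (p456171: the fold at the name in chain ∕ residue currency, the chain built from the SOCKET).  STATUS OF RECORD: N26 = binder
B4 is DEPENDENT on (D4) and VACATED in the discharge form of record (closes WITH B3 = N25, NODE O); the (D4)-chain instance for Bałaban's objects is 0∕1.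

WHY THIS FILE.  The row-(D4) owner's capstone `Beta.RemainderStepAdapterHolo.remainderConst_of_stepLeafLists` («HOW (D4) CLOSES FROM THE H-LAYER, in one
statement») lists, for a generic β-family and split, EVERY input under which the tree derives the (D4) END `|β¹_{k+1}| ≤ ε₁·K_rem,L`: per (scale, history) an
exhausting torus family, THIN STEP OBJECTS `StepObjectD4 4 (Nt k p n)` (configurations `Φ`, analyticity domains `sp2 X` = 𝔘ᶜ_{k+1}(X, α₀, α₁), RESUMMED
ACTIVITIES `H Z` of [II] (2.9)∕(2.37); `E := locE H` = (2.13) AS A DEFINITION) with Lemma 3 (2.38) `Lemma3OnH c ℓ` on the activities, SEAMS `emb` into the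
analyticity domains along which the activities are ℂ-differentiable ([II] p. 15, [I] (4.4) p. 281), the (190)-side data `Data190` ([15]), the (1.7)-factorization ∕
test-vector-limit data, plus the (1.22) identification and the numerics N1–N3.  Binder B4 is ONE CLAUSE MORE on the same object (`Gaps.BetaContFromD4Chain`: (C-pt)).
This file is the B4 TWIN of that capstone AT NODE 00's β OF RECORD: the same H-layer list, the (1.22) identification written IN THE RECORD'S LETTERS
(`β_merged,k+1(p) = β⁰_{k+1} + Σ_z (Σ'_Y A1 k p Y z) z_μ z_ν` on the box — gen 2's `betaMergedOfRecord₁₁_eq_of_chainTFac190H` read backwards), and (C-pt) on the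
EXPOSED leaf kernels `A1` ⟹ `BetaContH γ₀ (betaOfRecord₁₁ F N θ)`; the (D4)-chain inhabitant at `oneLoopSplitOfRecord₁₁ θ` is BUILT on the way
(`toPolLeavesTFac190H_ofActivities` BY NAME per (k, p)), with its leaf kernels exposed (`∃ R, R.A1 = A1`) so that (C-pt) is a statement about the given `A1`.
* §1 `beta1_eq_oneLoopSplitOfRecord₁₁_of_merged` — the record letters give the chain's field `beta1_eq` at the record's split (box `γ₀ ≤ θ.γ`).
* §2 LEAF-LIST currency (`Beta.RemainderLocalityHolo.PolLeavesTFac190H` per (k, p)): `exists_chainTFac190H_oneLoopSplitOfRecord₁₁_of_leafLists` (`∃ R, R.A1 = A1`);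
  the consumers of an exposed-kernel instance `betaContH_betaOfRecord₁₁_of_exists_chainTFac190H` ∕ `atSlopeCont_oneLoopSplitOfRecord₁₁_of_exists_chainTFac190H`
  ((C-pt) stated on `A1`); `betaContH_betaOfRecord₁₁_of_leafLists`; and «N26 closes WITH N25» at the datum from leaf lists + row (D1)'s residue,
  `endpoint_and_n26_datumOfRecord₁₁_of_leafLists`.
* §3 STEP-OBJECT (H-LAYER) currency: `exists_chainTFac190H_oneLoopSplitOfRecord₁₁_of_stepObjects` — THE INSTANCE from the crew's list;
  `betaContH_betaOfRecord₁₁_of_stepObjects` — HOW B4 CLOSES AT THE RECORD FROM THE H-LAYER, in one statement; `atSlopeCont_oneLoopSplitOfRecord₁₁_of_stepObjects` —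
  the rows-(D4) ∧ B4 residue at the record's split from the same list + smallness (what N25's END consumes, §2 ∕ p456171 §5).

HONEST FRAMING.  Compositions BY NAME (0 `def`, 0 `sorry`, no estimate); nothing of Bałaban's is constructed: his step objects, activities with (2.38), seams, (190)
data and (1.7) data AT THE STAGE-11 RECORD are NODE O's ∕ row (D4)'s objects (the crew's objects-side halves `B13Core214EntryHolomorphic` p435418,
`B13TermWalksPullback` p445942 give no `StepObjectD4` family for the record's merged term family) — INSTANCE 0∕1, D4 DISCHARGE NO DATE; the (1.22) identification
in the record's letters and (C-pt) are located hypotheses of NODE O; the zero-activity witness is NOT used.  θ-keyed implications only (no record-predicate ∀-form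
here; the ∀-forms of p449759 ∕ p456171 are NOT-A-DISCHARGE under the INHABITED-AT-₁₁C guard).  N25 ∕ N26 NOT discharged; counts unmoved.  One finite four-torus
programme at fixed ε per run — NOT the continuum limit, NOT ℝ⁴, NOT infinite volume, NOT OS, NOT a mass gap, NOT Clay.
Sources (context): [I] = [Balaban1987RG1] CMP **109** (1987): Thm 2 p. 259, (1.6)–(1.7) p. 261, (1.20)–(1.22) p. 264, (2.12)–(2.13) p. 268, (4.4) p. 281, (4.35)
p. 290, (5.10) p. 293; [II] = [Balaban1988RG2Cluster] CMP **116** (1988): (2.9)∕(2.13) p. 14, p. 15, Lemma 3 (2.38) p. 20; [15] = [Balaban1985Variational] CMP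
**102** (1985): (190) p. 308.
-/

noncomputable section

open scoped Matrix.Norms.L2Operator

namespace Summit.QuantumFields.YangMills.Theorems.BalabanUVNodesN26AtBetaOfRecord11StepObjects

open Literature.MathematicalPhysics.QuantumFieldTheory.Balaban1983to89
open Literature.MathematicalPhysics.QuantumFieldTheory.Balaban1983to89.FlowStep
open Literature.MathematicalPhysics.QuantumFieldTheory.Balaban1983to89.DagBinding (EndpointExistence)
open Literature.MathematicalPhysics.QuantumFieldTheory.Balaban1983to89.T4Continuum (T4Family)
open Literature.MathematicalPhysics.QuantumFieldTheory.Balaban1983to89.Node00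
open Literature.MathematicalPhysics.QuantumFieldTheory.Balaban1983to89.B13ScaleTransfer (Pt)
open Literature.MathematicalPhysics.QuantumFieldTheory.Balaban1983to89.TreeLengthTorus (TDom proj)
open Literature.MathematicalPhysics.QuantumFieldTheory.Balaban1983to89.B12Decay510 (mixedDeriv)
open Literature.MathematicalPhysics.QuantumFieldTheory.Balaban1983to89.Beta.RemainderChainLattice
open Literature.MathematicalPhysics.QuantumFieldTheory.Balaban1983to89.Beta.RemainderLimitTorus (LDom limKernel tproj)
open Literature.MathematicalPhysics.QuantumFieldTheory.Balaban1983to89.Beta.RemainderDecay190 (Consts190 Data190)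
open Literature.MathematicalPhysics.QuantumFieldTheory.Balaban1983to89.Beta.RemainderLocalityHolo (PolLeavesTFac190H)
open Literature.MathematicalPhysics.QuantumFieldTheory.Balaban1983to89.Beta.RemainderDecay190HoloChain (ChainTFac190H)
open Literature.MathematicalPhysics.QuantumFieldTheory.Balaban1983to89.Beta.RemainderStepAdapterHolo
  (StepObjectD4 toPolLeavesTFac190H_ofActivities)
open Literature.MathematicalPhysics.QuantumFieldTheory.Balaban1983to89.Beta.OneStepKernelFamily (TbalOf)
open Literature.MathematicalPhysics.QuantumFieldTheory.Balaban1983to89.Beta.OneStepResolventKernel (JetData)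
open Summit.QuantumFields.BalabanUV.Gaps
open Summit.QuantumFields.BalabanUV.Gaps.BetaContFromD4Chain
open Summit.QuantumFields.YangMills.Theorems.BalabanUVNodesN26AtBetaOfRecord11
  (betaContH_betaOfRecord₁₁_of_chainTFac190H endpoint_and_n26_datumOfRecord₁₁_of_residue_atSlopeCont)
open Metric Filter Topology

variable (F : T4Family) (N : ℕ) [NeZero N]

/-! ## §1 The (1.22) identification in the record's letters gives the chain's `beta1_eq` at the record's split -/

/-- **THE RECORD LETTERS GIVE THE CHAIN'S FIELD `beta1_eq` AT `oneLoopSplitOfRecord₁₁ θ`** (box `γ₀ ≤ θ.γ`): if on `]0,γ₀]^{k+1}` the MERGED β of record IS the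
one-loop number of record plus the second moment (1.22) of a leaf-sum kernel `Σ'_Y A1 k p Y ·` ([I] (2.12)–(2.13) + (1.7) at second-moment level — NODE O's located
identity for Bałaban's kernels), then the record split's remainder `β¹ = 𝟙_box·(β_merged − β⁰)` IS that second moment on the box — the converse reading of
p456171's `betaMergedOfRecord₁₁_eq_of_chainTFac190H`. [cite: Balaban1987RG1, (1.7) p.261, (1.20)-(1.22) p.264 and (2.12)-(2.13) p.268] -/
theorem beta1_eq_oneLoopSplitOfRecord₁₁_of_merged (θ : Stage11Params F N) {γ₀ : ℝ} (hle : γ₀ ≤ θ.γ) {μ ν : Fin 4}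
    (A1 : (k : ℕ) → (Fin (k + 1) → ℝ) → LDom 4 → Pt 4 → ℝ)
    (hm : ∀ k (p : Fin (k + 1) → ℝ), p ∈ Box γ₀ k →
      betaMergedOfRecord₁₁ F N θ k p = beta0OfRecord₁₁ F N θ k + B12Beta.secondMoment (fun _ _ => limKernel (A1 k p)) μ ν) :
    ∀ k (p : Fin (k + 1) → ℝ), p ∈ B12Beta.HistBox γ₀ k →
      (oneLoopSplitOfRecord₁₁ F N θ).β1 k p = B12Beta.secondMoment (fun _ _ => limKernel (A1 k p)) μ ν := by
  intro k p hp
  have hp' : p ∈ Box γ₀ k := (histBox_eq_box γ₀ k) ▸ hp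
  show (Box θ.γ k).indicator (fun w => betaMergedOfRecord₁₁ F N θ k w - beta0OfRecord₁₁ F N θ k) p = _
  rw [Set.indicator_of_mem (box_mono hle k hp'), hm k p hp']
  ring

/-! ## §2 Leaf-list currency: the instance with exposed leaf kernels, its B4 ∕ residue consumers, and «N26 closes WITH N25» at the datum -/

section LeafLists

variable {γ₀ : ℝ} {M : ℕ} [NeZero M] {μ ν : Fin 4} {c : B13.Consts} {ℓ α₂ : ℝ} {q : Consts190}

/-- **THE (D4)-CHAIN INSTANCE AT THE RECORD'S SPLIT FROM LEAF LISTS, LEAF KERNELS EXPOSED**: leaf kernels `A1 k p`, the (1.22) identification in the record's letters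
on a box `γ₀ ≤ θ.γ`, and per (k, p) in the box a holomorphic-currency (190)-leaf list `PolLeavesTFac190H 4 M (A1 k p) c ℓ α₂ q` ([II]-(2.38) ∕ (190) ∕ (4.4) ∕ (1.7) torus
leaf records — e.g. §3's, from the crew's step objects) ⟹ `∃ R : ChainTFac190H 4 M μ ν (oneLoopSplitOfRecord₁₁ F N θ) γ₀ c ℓ α₂ q, R.A1 = A1`.  Every input a located
hypothesis of NODE O; instance 0∕1. [cite: Balaban1987RG1, (1.7) p.261, (1.20)-(1.22) p.264 and (4.4) p.281; Balaban1988RG2Cluster, Lemma 3 (2.38) p.20; Balaban1985Variational, (190) p.308] -/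
theorem exists_chainTFac190H_oneLoopSplitOfRecord₁₁_of_leafLists (θ : Stage11Params F N) (hle : γ₀ ≤ θ.γ)
    (A1 : (k : ℕ) → (Fin (k + 1) → ℝ) → LDom 4 → Pt 4 → ℝ)
    (hm : ∀ k (p : Fin (k + 1) → ℝ), p ∈ Box γ₀ k →
      betaMergedOfRecord₁₁ F N θ k p = beta0OfRecord₁₁ F N θ k + B12Beta.secondMoment (fun _ _ => limKernel (A1 k p)) μ ν)
    (L : ∀ k (p : Fin (k + 1) → ℝ), p ∈ Box γ₀ k → PolLeavesTFac190H 4 M (A1 k p) c ℓ α₂ q) :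
    ∃ R : ChainTFac190H 4 M μ ν (oneLoopSplitOfRecord₁₁ F N θ) γ₀ c ℓ α₂ q, R.A1 = A1 :=
  ⟨⟨A1, beta1_eq_oneLoopSplitOfRecord₁₁_of_merged F N θ hle A1 hm, fun k p hp => L k p ((histBox_eq_box γ₀ k) ▸ hp)⟩, rfl⟩

/-- **B4 AT THE β OF RECORD FROM AN EXPOSED-KERNEL INSTANCE**: `∃ R, R.A1 = A1` at the record's split, the side conditions N1–N3 and (C-pt) STATED ON THE GIVEN LEAF
KERNELS (`p ↦ Σ'_Y A1 k p Y x` continuous on the box, per scale and site) ⟹ `BetaContH γ₀ (betaOfRecord₁₁ F N θ)` (p456171's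
`betaContH_betaOfRecord₁₁_of_chainTFac190H`; `CPt R` IS the displayed clause once `R.A1 = A1`). [cite: Balaban1987RG1, (1.22) p.264 and (5.10) p.293; Balaban1988RG2Cluster, Lemma 3 (2.38) p.20] -/
theorem betaContH_betaOfRecord₁₁_of_exists_chainTFac190H (θ : Stage11Params F N) {A1 : (k : ℕ) → (Fin (k + 1) → ℝ) → LDom 4 → Pt 4 → ℝ}
    (h : ∃ R : ChainTFac190H 4 M μ ν (oneLoopSplitOfRecord₁₁ F N θ) γ₀ c ℓ α₂ q, R.A1 = A1)
    (hC : CondsL 4 c ℓ) (h22 : c.R22gen ℓ) (hq : q.Valid c.δ₀) (hs : SignsL c α₂ q.B₃)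
    (hcpt : ∀ k (x : Pt 4), ContinuousOn (fun p : Fin (k + 1) → ℝ => limKernel (A1 k p) x) (Box γ₀ k)) :
    BetaContH γ₀ (betaOfRecord₁₁ F N θ) := by
  obtain ⟨R, hA⟩ := h
  subst hA
  exact betaContH_betaOfRecord₁₁_of_chainTFac190H F N θ R hC h22 hq hs hcpt

/-- **THE ROWS-(D4) ∧ B4 RESIDUE AT THE RECORD'S SPLIT FROM AN EXPOSED-KERNEL INSTANCE** + N1–N3 + smallness `ε₁·K_rem,L ≤ s` + (C-pt) on the given leaf kernels:
`AtSlopeCont (oneLoopSplitOfRecord₁₁ F N θ) γ₀ s` (`Gaps.BetaContFromD4Chain.atSlopeCont_of_chainTFac190H`) — the predicate N25's END consumes at `s := stepBal Nc Lc`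
(p456171 §5). [cite: Balaban1988RG2Cluster, Lemma 3 (2.38) p.20; Balaban1987RG1, (1.20)-(1.22) p.264 and (5.10) p.293] -/
theorem atSlopeCont_oneLoopSplitOfRecord₁₁_of_exists_chainTFac190H (θ : Stage11Params F N)
    {A1 : (k : ℕ) → (Fin (k + 1) → ℝ) → LDom 4 → Pt 4 → ℝ}
    (h : ∃ R : ChainTFac190H 4 M μ ν (oneLoopSplitOfRecord₁₁ F N θ) γ₀ c ℓ α₂ q, R.A1 = A1)
    (hC : CondsL 4 c ℓ) (h22 : c.R22gen ℓ) (hq : q.Valid c.δ₀) (hs : SignsL c α₂ q.B₃) {s : ℝ}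
    (hsmall : c.ε₁ * remCoeffL 4 M c α₂ q.B₃ ≤ s)
    (hcpt : ∀ k (x : Pt 4), ContinuousOn (fun p : Fin (k + 1) → ℝ => limKernel (A1 k p) x) (Box γ₀ k)) :
    AtSlopeCont (oneLoopSplitOfRecord₁₁ F N θ) γ₀ s := by
  obtain ⟨R, hA⟩ := h
  subst hA
  exact atSlopeCont_of_chainTFac190H R hC h22 hq hs hsmall hcpt

/-- **B4 AT THE β OF RECORD FROM LEAF LISTS**: leaf kernels + the (1.22) identification in the record's letters (box `γ₀ ≤ θ.γ`) + per-(k, p) (190)-leaf lists + N1–N3 +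
(C-pt) on the leaf kernels ⟹ `BetaContH γ₀ (betaOfRecord₁₁ F N θ)`.  Instance 0∕1 for Bałaban's objects. [cite: Balaban1987RG1, (1.7) p.261, (1.20)-(1.22) p.264 and (5.10) p.293; Balaban1988RG2Cluster, Lemma 3 (2.38) p.20] -/
theorem betaContH_betaOfRecord₁₁_of_leafLists (θ : Stage11Params F N) (hle : γ₀ ≤ θ.γ)
    (A1 : (k : ℕ) → (Fin (k + 1) → ℝ) → LDom 4 → Pt 4 → ℝ)
    (hm : ∀ k (p : Fin (k + 1) → ℝ), p ∈ Box γ₀ k →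
      betaMergedOfRecord₁₁ F N θ k p = beta0OfRecord₁₁ F N θ k + B12Beta.secondMoment (fun _ _ => limKernel (A1 k p)) μ ν)
    (L : ∀ k (p : Fin (k + 1) → ℝ), p ∈ Box γ₀ k → PolLeavesTFac190H 4 M (A1 k p) c ℓ α₂ q)
    (hC : CondsL 4 c ℓ) (h22 : c.R22gen ℓ) (hq : q.Valid c.δ₀) (hs : SignsL c α₂ q.B₃)
    (hcpt : ∀ k (x : Pt 4), ContinuousOn (fun p : Fin (k + 1) → ℝ => limKernel (A1 k p) x) (Box γ₀ k)) :
    BetaContH γ₀ (betaOfRecord₁₁ F N θ) :=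
  betaContH_betaOfRecord₁₁_of_exists_chainTFac190H F N θ
    (exists_chainTFac190H_oneLoopSplitOfRecord₁₁_of_leafLists F N θ hle A1 hm L) hC h22 hq hs hcpt

/-- **N25's END ∧ N26 AT THE STAGE-11 DATUM FROM LEAF LISTS + ROW (D1)'s RESIDUE**: row (D1)'s residue `Gaps.D1Residue.Residue Lc Js Nc μ' ν'` pinned on
`beta0OfRecord₁₁ θ`, and on a box `0 < γ₀ ≤ θ.γ` the leaf kernels with the (1.22) identification in the record's letters, per-(k, p) (190)-leaf lists, N1–N3, the
one-loop slope `ε₁·K_rem,L ≤ stepBal Nc Lc` and (C-pt) on the leaf kernels ⟹ `EndpointExistence D.C.toB12 ∧ ∃ γc > 0, BetaContH γc D.βfun` at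
`D := datumOfRecord₁₁ F N θ hP` (p456171's `endpoint_and_n26_datumOfRecord₁₁_of_residue_atSlopeCont`).  Instance 0∕1 on (D1) and (D4); N25 ∕ N26 NOT discharged.
[cite: Balaban1987RG1, Thm 2 p.259 (first sentence), (1.7) p.261 and (1.20)-(1.22) p.264; Balaban1988RG2Cluster, Lemma 3 (2.38) p.20] -/
theorem endpoint_and_n26_datumOfRecord₁₁_of_leafLists (θ : Stage11Params F N) (hP : θ.Provisos₁₁) {Lc : ℕ} [NeZero Lc]
    (Js : ℕ → JetData 3 Lc) {Nc : ℝ} {μ' ν' : Fin 4} (hβ : ∀ j, beta0OfRecord₁₁ F N θ j = B12Beta.secondMoment (TbalOf Lc Js j) μ' ν')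
    (h1 : D1Residue.Residue Lc Js Nc μ' ν') (hγ₀ : 0 < γ₀) (hle : γ₀ ≤ θ.γ)
    (A1 : (k : ℕ) → (Fin (k + 1) → ℝ) → LDom 4 → Pt 4 → ℝ)
    (hm : ∀ k (p : Fin (k + 1) → ℝ), p ∈ Box γ₀ k →
      betaMergedOfRecord₁₁ F N θ k p = beta0OfRecord₁₁ F N θ k + B12Beta.secondMoment (fun _ _ => limKernel (A1 k p)) μ ν)
    (L : ∀ k (p : Fin (k + 1) → ℝ), p ∈ Box γ₀ k → PolLeavesTFac190H 4 M (A1 k p) c ℓ α₂ q)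
    (hC : CondsL 4 c ℓ) (h22 : c.R22gen ℓ) (hq : q.Valid c.δ₀) (hs : SignsL c α₂ q.B₃)
    (hsmall : c.ε₁ * remCoeffL 4 M c α₂ q.B₃ ≤ B12Normalization.stepBal Nc Lc)
    (hcpt : ∀ k (x : Pt 4), ContinuousOn (fun p : Fin (k + 1) → ℝ => limKernel (A1 k p) x) (Box γ₀ k)) :
    EndpointExistence (datumOfRecord₁₁ F N θ hP).C.toB12 ∧ ∃ γc : ℝ, 0 < γc ∧ BetaContH γc (datumOfRecord₁₁ F N θ hP).βfun :=
  endpoint_and_n26_datumOfRecord₁₁_of_residue_atSlopeCont F N θ hP Js hβ h1 hγ₀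
    (atSlopeCont_oneLoopSplitOfRecord₁₁_of_exists_chainTFac190H F N θ
      (exists_chainTFac190H_oneLoopSplitOfRecord₁₁_of_leafLists F N θ hle A1 hm L) hC h22 hq hs hsmall hcpt)

end LeafLists

/-! ## §3 Step-object (H-layer) currency: the instance, B4 and the residue at the record from the crew's list, BY NAME -/

section StepObjects

variable {γ₀ : ℝ} {M : ℕ} [NeZero M] {μ ν : Fin 4} {c : B13.Consts} {ℓ α₂ : ℝ} {q : Consts190}

/-- **THE (D4)-CHAIN INSTANCE AT THE RECORD'S SPLIT FROM THE CREW'S STEP OBJECTS** (row-(D4) owner's `toPolLeavesTFac190H_ofActivities` BY NAME per (scale, history)):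
leaf kernels `A1` with the (1.22) identification in the record's letters on a box `γ₀ ≤ θ.γ`, and PER (k, p): an exhausting torus family `Nt k p`, thin step objects
`O k p n : StepObjectD4 4 (Nt k p n)` (configurations, analyticity domains 𝔘ᶜ_{k+1}(X, α₀, α₁), resummed activities `H`; `E` = (2.13) as a definition) with Lemma 3
(2.38) `Lemma3OnH c ℓ` on the activities, seams `emb k p n X` into the analyticity domains (`hemb`) with the ACTIVITIES ℂ-differentiable along them (`hH`, [II] p. 15 ∕
[I] (4.4)), the (190)-side data `D k p : Data190 4 M (Nt k p) (Wn k p) q` ([15] (190)), the (1.7)-factorization ∕ test-vector-limit data `(V, Fw, hFd, r, hfac, t, hconv)`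
with the read-out `ha : A1 k p Y z = Re ∂²(Fw k p Y)(t Y 0, t Y z)`, under N1 `CondsL` and the signs `SignsL` (for `0 ≤ C₃ε₁`) ⟹
`∃ R : ChainTFac190H 4 M μ ν (oneLoopSplitOfRecord₁₁ F N θ) γ₀ c ℓ α₂ q, R.A1 = A1`.  THIS is the (D4)-chain instance at `betaOfRecord₁₁` «from the crew's D4
files by name»; for Bałaban's construction every object in the list is NODE O's (instance 0∕1).
[cite: Balaban1987RG1, (1.7) p.261, (1.21)-(1.22) p.264, (4.4) p.281 and (4.35) p.290; Balaban1988RG2Cluster, (2.9) p.14, p.15 and (2.38) p.20; Balaban1985Variational, (190) p.308] -/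
theorem exists_chainTFac190H_oneLoopSplitOfRecord₁₁_of_stepObjects (θ : Stage11Params F N) (hle : γ₀ ≤ θ.γ)
    (hC : CondsL 4 c ℓ) (hs : SignsL c α₂ q.B₃)
    (A1 : (k : ℕ) → (Fin (k + 1) → ℝ) → LDom 4 → Pt 4 → ℝ)
    (hm : ∀ k (p : Fin (k + 1) → ℝ), p ∈ Box γ₀ k →
      betaMergedOfRecord₁₁ F N θ k p = beta0OfRecord₁₁ F N θ k + B12Beta.secondMoment (fun _ _ => limKernel (A1 k p)) μ ν)
    -- per (scale, history): the torus family, the step objects, (2.38), the seams, the H-layer datum, the (190) data, the (1.7) data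
    (Nt : (k : ℕ) → (Fin (k + 1) → ℝ) → ℕ → ℕ) (hN : ∀ k p n, NeZero (Nt k p n))
    (hNlim : ∀ k p, Tendsto (Nt k p) atTop atTop)
    (O : (k : ℕ) → (p : Fin (k + 1) → ℝ) → (n : ℕ) → StepObjectD4 4 (Nt k p n))
    (h3 : ∀ k p n, (O k p n).Lemma3OnH c ℓ)
    (Wn : (k : ℕ) → (Fin (k + 1) → ℝ) → ℕ → Type) (instW : ∀ k p n, NormedAddCommGroup (Wn k p n))
    (instWs : ∀ k p n, NormedSpace ℂ (Wn k p n))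
    (emb : (k : ℕ) → (p : Fin (k + 1) → ℝ) → (n : ℕ) → TDom 4 (Nt k p n) → Wn k p n → (O k p n).Φ)
    (hemb : ∀ k p n X, ∀ v ∈ ball (0 : Wn k p n) α₂, emb k p n X v ∈ (O k p n).sp2 X)
    (hH : ∀ k p n (X Z : TDom 4 (Nt k p n)), Z.1 ⊆ X.1 →
      DifferentiableOn ℂ (fun v => (O k p n).H Z (emb k p n X v)) (ball 0 α₂))
    (D : (k : ℕ) → (p : Fin (k + 1) → ℝ) → Data190 4 M (Nt k p) (Wn k p) q)
    (V : (k : ℕ) → (Fin (k + 1) → ℝ) → LDom 4 → Type) (instV : ∀ k p Y, NormedAddCommGroup (V k p Y))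
    (instVs : ∀ k p Y, NormedSpace ℂ (V k p Y))
    (Fw : (k : ℕ) → (p : Fin (k + 1) → ℝ) → (Y : LDom 4) → V k p Y → ℂ)
    (hFd : ∀ k p Y, ∃ ρ > 0, DifferentiableOn ℂ (Fw k p Y) (ball 0 ρ))
    (r : (k : ℕ) → (p : Fin (k + 1) → ℝ) → (n : ℕ) → (Y : LDom 4) → Wn k p n →L[ℂ] V k p Y)
    (hfac : ∀ k p (Y : LDom 4), ∀ᶠ n in atTop, ∀ v ∈ ball (0 : Wn k p n) α₂,
      (O k p n).E (tproj (Nt k p n) Y) (emb k p n (tproj (Nt k p n) Y) v) = Fw k p Y (r k p n Y v))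
    (t : (k : ℕ) → (p : Fin (k + 1) → ℝ) → (Y : LDom 4) → Pt 4 → V k p Y)
    (hconv : ∀ k p (Y : LDom 4) (x : Pt 4),
      Tendsto (fun n => r k p n Y ((D k p).hn n (tproj (Nt k p n) Y) (proj (Nt k p n * M) x))) atTop (𝓝 (t k p Y x)))
    (ha : ∀ k p (Y : LDom 4) (z : Pt 4), A1 k p Y z = (mixedDeriv (Fw k p Y) (t k p Y 0) (t k p Y z)).re) :
    ∃ R : ChainTFac190H 4 M μ ν (oneLoopSplitOfRecord₁₁ F N θ) γ₀ c ℓ α₂ q, R.A1 = A1 :=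
  exists_chainTFac190H_oneLoopSplitOfRecord₁₁_of_leafLists F N θ hle A1 hm fun k p _ =>
    toPolLeavesTFac190H_ofActivities (hN := hN k p) (Nt k p) (hNlim k p) (O k p) c ℓ α₂ q (h3 k p) hC hs.A (Wn k p)
      (instW := instW k p) (instWs := instWs k p) (emb k p) (hemb k p) (hH k p) (D k p) (V k p) (instV := instV k p)
      (instVs := instVs k p) (Fw k p) (hFd k p) (r k p) (hfac k p) (t k p) (hconv k p) (A1 k p) (ha k p)

/-- **HOW B4 CLOSES AT THE β OF RECORD FROM THE H-LAYER, in one statement** (the B4 twin, at NODE 00's Stage-11 β, of the row-(D4) owner's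
`remainderConst_of_stepLeafLists`): the crew's step-object list of `exists_chainTFac190H_oneLoopSplitOfRecord₁₁_of_stepObjects` (step objects + (2.38) + seams +
H-layer holomorphy + (190) data + (1.7) ∕ test-vector data per (k, p)), the (1.22) identification in the record's letters, N1–N3 (`CondsL`, `R22gen`, `Valid`, `SignsL`)
and (C-pt) on the leaf kernels ⟹ `BetaContH γ₀ (betaOfRecord₁₁ F N θ)` for EVERY `θ : Stage11Params` with `γ₀ ≤ θ.γ`.  Displayed so that NODE O sees, at the record,
the complete list under which the tree derives binder B4; nothing of Bałaban's is asserted (instance 0∕1).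
[cite: Balaban1987RG1, (1.7) p.261, (1.20)-(1.22) p.264, (4.4) p.281 and (5.10) p.293; Balaban1988RG2Cluster, p.15 and (2.38) p.20; Balaban1985Variational, (190) p.308] -/
theorem betaContH_betaOfRecord₁₁_of_stepObjects (θ : Stage11Params F N) (hle : γ₀ ≤ θ.γ)
    (hC : CondsL 4 c ℓ) (h22 : c.R22gen ℓ) (hq : q.Valid c.δ₀) (hs : SignsL c α₂ q.B₃)
    (A1 : (k : ℕ) → (Fin (k + 1) → ℝ) → LDom 4 → Pt 4 → ℝ)
    (hm : ∀ k (p : Fin (k + 1) → ℝ), p ∈ Box γ₀ k →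
      betaMergedOfRecord₁₁ F N θ k p = beta0OfRecord₁₁ F N θ k + B12Beta.secondMoment (fun _ _ => limKernel (A1 k p)) μ ν)
    (Nt : (k : ℕ) → (Fin (k + 1) → ℝ) → ℕ → ℕ) (hN : ∀ k p n, NeZero (Nt k p n))
    (hNlim : ∀ k p, Tendsto (Nt k p) atTop atTop)
    (O : (k : ℕ) → (p : Fin (k + 1) → ℝ) → (n : ℕ) → StepObjectD4 4 (Nt k p n))
    (h3 : ∀ k p n, (O k p n).Lemma3OnH c ℓ)
    (Wn : (k : ℕ) → (Fin (k + 1) → ℝ) → ℕ → Type) (instW : ∀ k p n, NormedAddCommGroup (Wn k p n))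
    (instWs : ∀ k p n, NormedSpace ℂ (Wn k p n))
    (emb : (k : ℕ) → (p : Fin (k + 1) → ℝ) → (n : ℕ) → TDom 4 (Nt k p n) → Wn k p n → (O k p n).Φ)
    (hemb : ∀ k p n X, ∀ v ∈ ball (0 : Wn k p n) α₂, emb k p n X v ∈ (O k p n).sp2 X)
    (hH : ∀ k p n (X Z : TDom 4 (Nt k p n)), Z.1 ⊆ X.1 →
      DifferentiableOn ℂ (fun v => (O k p n).H Z (emb k p n X v)) (ball 0 α₂))
    (D : (k : ℕ) → (p : Fin (k + 1) → ℝ) → Data190 4 M (Nt k p) (Wn k p) q)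
    (V : (k : ℕ) → (Fin (k + 1) → ℝ) → LDom 4 → Type) (instV : ∀ k p Y, NormedAddCommGroup (V k p Y))
    (instVs : ∀ k p Y, NormedSpace ℂ (V k p Y))
    (Fw : (k : ℕ) → (p : Fin (k + 1) → ℝ) → (Y : LDom 4) → V k p Y → ℂ)
    (hFd : ∀ k p Y, ∃ ρ > 0, DifferentiableOn ℂ (Fw k p Y) (ball 0 ρ))
    (r : (k : ℕ) → (p : Fin (k + 1) → ℝ) → (n : ℕ) → (Y : LDom 4) → Wn k p n →L[ℂ] V k p Y)
    (hfac : ∀ k p (Y : LDom 4), ∀ᶠ n in atTop, ∀ v ∈ ball (0 : Wn k p n) α₂,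
      (O k p n).E (tproj (Nt k p n) Y) (emb k p n (tproj (Nt k p n) Y) v) = Fw k p Y (r k p n Y v))
    (t : (k : ℕ) → (p : Fin (k + 1) → ℝ) → (Y : LDom 4) → Pt 4 → V k p Y)
    (hconv : ∀ k p (Y : LDom 4) (x : Pt 4),
      Tendsto (fun n => r k p n Y ((D k p).hn n (tproj (Nt k p n) Y) (proj (Nt k p n * M) x))) atTop (𝓝 (t k p Y x)))
    (ha : ∀ k p (Y : LDom 4) (z : Pt 4), A1 k p Y z = (mixedDeriv (Fw k p Y) (t k p Y 0) (t k p Y z)).re)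
    (hcpt : ∀ k (x : Pt 4), ContinuousOn (fun p : Fin (k + 1) → ℝ => limKernel (A1 k p) x) (Box γ₀ k)) :
    BetaContH γ₀ (betaOfRecord₁₁ F N θ) :=
  betaContH_betaOfRecord₁₁_of_exists_chainTFac190H F N θ
    (exists_chainTFac190H_oneLoopSplitOfRecord₁₁_of_stepObjects F N θ hle hC hs A1 hm Nt hN hNlim O h3 Wn instW instWs emb hemb hH D V
      instV instVs Fw hFd r hfac t hconv ha) hC h22 hq hs hcpt

/-- **THE ROWS-(D4) ∧ B4 RESIDUE AT THE RECORD'S SPLIT FROM THE H-LAYER**: the same step-object list, the (1.22) identification in the record's letters, N1–N3,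
smallness `ε₁·K_rem,L ≤ s` and (C-pt) on the leaf kernels ⟹ `AtSlopeCont (oneLoopSplitOfRecord₁₁ F N θ) γ₀ s` — the β-side (D4)∧B4 predicate that, with row
(D1)'s residue pinned on `beta0OfRecord₁₁ θ`, gives N25's END ∧ N26 at the Stage-11 datum (p456171 §5) and hence the β-side shape of route crux K2
`EndpointGivenBR11`.  Nothing of Bałaban's asserted (instance 0∕1). [cite: Balaban1988RG2Cluster, p.15 and Lemma 3 (2.38) p.20; Balaban1987RG1, (1.7) p.261, (1.20)-(1.22) p.264, (4.4) p.281 and (5.10) p.293; Balaban1985Variational, (190) p.308] -/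
theorem atSlopeCont_oneLoopSplitOfRecord₁₁_of_stepObjects (θ : Stage11Params F N) (hle : γ₀ ≤ θ.γ)
    (hC : CondsL 4 c ℓ) (h22 : c.R22gen ℓ) (hq : q.Valid c.δ₀) (hs : SignsL c α₂ q.B₃) {s : ℝ}
    (hsmall : c.ε₁ * remCoeffL 4 M c α₂ q.B₃ ≤ s)
    (A1 : (k : ℕ) → (Fin (k + 1) → ℝ) → LDom 4 → Pt 4 → ℝ)
    (hm : ∀ k (p : Fin (k + 1) → ℝ), p ∈ Box γ₀ k →
      betaMergedOfRecord₁₁ F N θ k p = beta0OfRecord₁₁ F N θ k + B12Beta.secondMoment (fun _ _ => limKernel (A1 k p)) μ ν)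
    (Nt : (k : ℕ) → (Fin (k + 1) → ℝ) → ℕ → ℕ) (hN : ∀ k p n, NeZero (Nt k p n))
    (hNlim : ∀ k p, Tendsto (Nt k p) atTop atTop)
    (O : (k : ℕ) → (p : Fin (k + 1) → ℝ) → (n : ℕ) → StepObjectD4 4 (Nt k p n))
    (h3 : ∀ k p n, (O k p n).Lemma3OnH c ℓ)
    (Wn : (k : ℕ) → (Fin (k + 1) → ℝ) → ℕ → Type) (instW : ∀ k p n, NormedAddCommGroup (Wn k p n))
    (instWs : ∀ k p n, NormedSpace ℂ (Wn k p n))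
    (emb : (k : ℕ) → (p : Fin (k + 1) → ℝ) → (n : ℕ) → TDom 4 (Nt k p n) → Wn k p n → (O k p n).Φ)
    (hemb : ∀ k p n X, ∀ v ∈ ball (0 : Wn k p n) α₂, emb k p n X v ∈ (O k p n).sp2 X)
    (hH : ∀ k p n (X Z : TDom 4 (Nt k p n)), Z.1 ⊆ X.1 →
      DifferentiableOn ℂ (fun v => (O k p n).H Z (emb k p n X v)) (ball 0 α₂))
    (D : (k : ℕ) → (p : Fin (k + 1) → ℝ) → Data190 4 M (Nt k p) (Wn k p) q)
    (V : (k : ℕ) → (Fin (k + 1) → ℝ) → LDom 4 → Type) (instV : ∀ k p Y, NormedAddCommGroup (V k p Y))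
    (instVs : ∀ k p Y, NormedSpace ℂ (V k p Y))
    (Fw : (k : ℕ) → (p : Fin (k + 1) → ℝ) → (Y : LDom 4) → V k p Y → ℂ)
    (hFd : ∀ k p Y, ∃ ρ > 0, DifferentiableOn ℂ (Fw k p Y) (ball 0 ρ))
    (r : (k : ℕ) → (p : Fin (k + 1) → ℝ) → (n : ℕ) → (Y : LDom 4) → Wn k p n →L[ℂ] V k p Y)
    (hfac : ∀ k p (Y : LDom 4), ∀ᶠ n in atTop, ∀ v ∈ ball (0 : Wn k p n) α₂,
      (O k p n).E (tproj (Nt k p n) Y) (emb k p n (tproj (Nt k p n) Y) v) = Fw k p Y (r k p n Y v))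
    (t : (k : ℕ) → (p : Fin (k + 1) → ℝ) → (Y : LDom 4) → Pt 4 → V k p Y)
    (hconv : ∀ k p (Y : LDom 4) (x : Pt 4),
      Tendsto (fun n => r k p n Y ((D k p).hn n (tproj (Nt k p n) Y) (proj (Nt k p n * M) x))) atTop (𝓝 (t k p Y x)))
    (ha : ∀ k p (Y : LDom 4) (z : Pt 4), A1 k p Y z = (mixedDeriv (Fw k p Y) (t k p Y 0) (t k p Y z)).re)
    (hcpt : ∀ k (x : Pt 4), ContinuousOn (fun p : Fin (k + 1) → ℝ => limKernel (A1 k p) x) (Box γ₀ k)) :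
    AtSlopeCont (oneLoopSplitOfRecord₁₁ F N θ) γ₀ s :=
  atSlopeCont_oneLoopSplitOfRecord₁₁_of_exists_chainTFac190H F N θ
    (exists_chainTFac190H_oneLoopSplitOfRecord₁₁_of_stepObjects F N θ hle hC hs A1 hm Nt hN hNlim O h3 Wn instW instWs emb hemb hH D V
      instV instVs Fw hFd r hfac t hconv ha) hC h22 hq hs hsmall hcpt

end StepObjects

end Summit.QuantumFields.YangMills.Theorems.BalabanUVNodesN26AtBetaOfRecord11StepObjects

end
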